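import Summits.ResolutionOfSingularities.ResolutionOfSingularities.Theorems.WildConesCampaignW46HypersurfacesCharTwoTangentCubicKernel

/-!
# [OURS · L1 W4.6, rung (ii) at p = 2, EVERY dimension n] THE CONVERSE LINK: at corank `e = 2`,
# `h₂ = 3` IF AND ONLY IF the tangent cubic vanishes on the kernel plane AS A FORM (all its polars vanish
# there) — `z² = a(u₁,…,uₙ)` over every field of characteristic 2

HONEST FRAMING. Everything here is OURS: theorems about route WildCones' own TYPED point-blow-up dynamics
(`Theorems/WildConesClassicalRegimesDefs.lean`) and the seat's invariants `milnorEmbDim` (p498937),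
`milnorHilbertTwo` (p511581), `polarMatrix` (p502936), `degForm` (p522667). NOTHING here is a statement of
the manuscript [Hironaka2017]; no FACT-LIST premise; AI review is weaker than expert review. Cell
res-hironaka (LADDER-RESOLUTION rung L, D-0089), slot W4.6, seat res-L1-s46-pv-4 (gen 5); host route
`WildCones`, crux `ClassicalRegimes` (stmt-ResolutionOfSingularities-16884; proved).

THE ARGUMENT. With the two linear forms `x, y` of the companion file `…SixClasses.lean` the six classes
`1, x, y, x², xy, y²` span `R/((∂a)+𝔪³)`, whose dimension is `h₂ + 3`; so `h₂ = 3` iff the six are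
INDEPENDENT. Given a relation, `1, x, y` are independent modulo `(∂a) + 𝔪²` (they span a space of
dimension `3`), so the relation is quadratic: `q = αx² + βxy + γy² ∈ (∂a) + 𝔪³`, i.e. `q ≡ j` with
`j ∈ (∂a) ∩ 𝔪² = {D_λ a : λ ∈ ker P} + 𝔪·(∂a)`. Evaluating degree-2 forms at kernel vectors `v`
(p528427) gives `α X(v)² + β X(v)Y(v) + γ Y(v)² = polar(λ, v)`, which VANISHES under the hypothesis.
Finally the linear forms `X = x₁`, `Y = y₁` are independent coordinates on `ker P` (every linear form is
`≡ αx + βy` modulo forms vanishing on `ker P`), so `(X, Y)` takes the values `(1,0), (0,1), (1,1)` on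
`ker P`, forcing `α = γ = β = 0`.

WHAT IS PROVED (every `n`, every field of characteristic `2`):

* `hypersurface_milnorHilbertTwo_eq_three_of_polar_eq_zero` — `e = 2` and all polars
  `Σₛ λₛ (∂ₛa)₂(v)` (`λ, v ∈ ker P`) vanish ⇒ `h₂ = 3`;
* `hypersurface_milnorHilbertTwo_eq_three_iff_polar` — **`e = 2`: `h₂ = 3` ⟺ the tangent cubic vanishes
  on the kernel plane as a form** (with `…TangentCubicKernel.lean`); `hypersurface_milnorHilbertTwo_le_two_iff_polar`
  — hence `h₂ ≤ 2` ⟺ some polar value on the kernel is non-zero. (Over `𝔽₂` a non-zero binary cubic form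
  may vanish at all three rational points of the kernel line — `st(s+t)` — so the VALUE-wise vanishing of
  `a₃` used in the near-point count p525636 is weaker than the FORM-wise condition here; whenever some
  kernel value `a₃(v) ≠ 0` exists, `…TangentCubicKernel.lean` gives the finite, isolated side.)

References: G.-M. Greuel, G. Pfister, J. Algebra 689 (2026) [GreuelPfister2026] (context); H. Hironaka,
ms. 2017 [Hironaka2017] — none of it used.
-/

noncomputable section

-- single-problem summit: the doubled namespace component `ResolutionOfSingularities` is forced
set_option linter.dupNamespace false

open scoped BigOperators Classical

open MvPowerSeries IsLocalRing

open Literature.AlgebraicGeometry.Resolution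

namespace Summit.ResolutionOfSingularities.ResolutionOfSingularities.Theorems

namespace CampaignW46.HypersurfacesCharTwo

open WildCones WildCones.MuDropCharTwoOrdP ThreefoldsCharTwo

variable {κ : Type} [Field κ] {n : ℕ}

/-! ## `1, x, y` are independent modulo `(∂f) + 𝔪²` -/

/-- [OURS · L1 W4.6] With `x, y` generating `𝔪` modulo `(∂f) + 𝔪²` and `jetTwoColength f = 3`: a linear
combination `c₀ + c₁ x + c₂ y ∈ (∂f) + 𝔪²` is trivial. (The classes of `1, x, y` span a `3`-dimensional
space, hence are independent.) [folklore] -/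
theorem coeffs_eq_zero_of_linear_mem {f : MvPowerSeries (Fin n) κ}
    (h3 : jetTwoColength f = 3) {x y : MvPowerSeries (Fin n) κ}
    (hgen : ∀ m ∈ maximalIdeal (MvPowerSeries (Fin n) κ), ∃ α β : κ,
      m - (C α * x + C β * y) ∈ Ideal.span (Set.range fun s => MvPowerSeries.pderiv s f) ⊔
        maximalIdeal (MvPowerSeries (Fin n) κ) ^ 2)
    {c₀ c₁ c₂ : κ} (h : C c₀ + C c₁ * x + C c₂ * y ∈
      Ideal.span (Set.range fun s => MvPowerSeries.pderiv s f) ⊔ maximalIdeal (MvPowerSeries (Fin n) κ) ^ 2) :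
    c₀ = 0 ∧ c₁ = 0 ∧ c₂ = 0 := by
  set I := Ideal.span (Set.range fun s => MvPowerSeries.pderiv s f) ⊔
    maximalIdeal (MvPowerSeries (Fin n) κ) ^ 2 with hI
  have hfr : Module.finrank κ (MvPowerSeries (Fin n) κ ⧸ I) = 3 := h3
  set v : Fin 3 → MvPowerSeries (Fin n) κ ⧸ I :=
    ![Ideal.Quotient.mk I 1, Ideal.Quotient.mk I x, Ideal.Quotient.mk I y] with hv
  -- spanning
  have hspan : ⊤ ≤ Submodule.span κ (Set.range v) := by
    have h0 : Ideal.Quotient.mk I 1 ∈ Submodule.span κ (Set.range v) := Submodule.subset_span ⟨0, rfl⟩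
    have h1 : Ideal.Quotient.mk I x ∈ Submodule.span κ (Set.range v) := Submodule.subset_span ⟨1, rfl⟩
    have h2 : Ideal.Quotient.mk I y ∈ Submodule.span κ (Set.range v) := Submodule.subset_span ⟨2, rfl⟩
    intro u _
    obtain ⟨r, rfl⟩ := Ideal.Quotient.mk_surjective u
    have hrm : r - C (constantCoeff r) ∈ maximalIdeal (MvPowerSeries (Fin n) κ) := by
      rw [Literature.RingTheory.MvPowerSeries.Jets.mem_maximalIdeal_iff_constantCoeff_eq_zero, map_sub,
        constantCoeff_C, sub_self]
    obtain ⟨α, β, hαβ⟩ := hgen _ hrm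
    have heq : Ideal.Quotient.mk I r = Ideal.Quotient.mk I (C (constantCoeff r) * 1 + (C α * x + C β * y)) := by
      refine Ideal.Quotient.eq.mpr ?_
      have : r - (C (constantCoeff r) * 1 + (C α * x + C β * y)) = r - C (constantCoeff r) - (C α * x + C β * y) := by
        ring
      rw [this]
      exact hαβ
    rw [heq, map_add, map_add, mk_C_mul, mk_C_mul, mk_C_mul]
    exact Submodule.add_mem _ (Submodule.smul_mem _ _ h0)
      (Submodule.add_mem _ (Submodule.smul_mem _ _ h1) (Submodule.smul_mem _ _ h2))
  have hli : LinearIndependent κ v :=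
    linearIndependent_of_top_le_span_of_card_eq_finrank hspan (by rw [hfr]; rfl)
  have hrel : ∑ i, (![c₀, c₁, c₂] : Fin 3 → κ) i • v i = 0 := by
    rw [Fin.sum_univ_three]
    simp only [hv, Matrix.cons_val_zero, Matrix.cons_val_one, Matrix.cons_val]
    rw [← mk_C_mul, ← mk_C_mul, ← mk_C_mul, ← map_add, ← map_add, mul_one]
    exact Ideal.Quotient.eq_zero_iff_mem.mpr h
  have hc := Fintype.linearIndependent_iff.mp hli _ hrel
  exact ⟨hc 0, hc 1, hc 2⟩

/-! ## The linear forms `x₁, y₁` are coordinates on the kernel -/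

/-- [OURS · L1 W4.6] Characteristic two: the linear coefficient of `Σₛ λₛ ∂ₛ f` at `X_t` is `(λ · P)_t`.
[folklore] -/
theorem coeff_single_sum_C_mul_pderiv [CharP κ 2] (f : MvPowerSeries (Fin n) κ) (lam : Fin n → κ)
    (t : Fin n) :
    coeff (Finsupp.single t 1) (∑ s, C (lam s) * MvPowerSeries.pderiv s f) =
      Matrix.vecMul lam (polarMatrix f) t := by
  rw [map_sum, Matrix.vecMul, dotProduct]
  refine Finset.sum_congr rfl fun s _ => ?_
  rw [coeff_C_mul, ← linPartials_eq_polarMatrix]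
  rfl

/-- [OURS · L1 W4.6] **Along a kernel vector, elements of `(∂f) + 𝔪²` have vanishing linear form.**
[folklore] -/
theorem degForm_one_eq_zero_of_mem_jac_sup_sq {f : MvPowerSeries (Fin n) κ}
    (hf : ∀ s, coeff (Finsupp.single s 1) f = 0) {v : Fin n → κ}
    (hv : ∀ s, degForm 1 (MvPowerSeries.pderiv s f) v = 0) {r : MvPowerSeries (Fin n) κ}
    (hr : r ∈ Ideal.span (Set.range fun s => MvPowerSeries.pderiv s f) ⊔ maximalIdeal (MvPowerSeries (Fin n) κ) ^ 2) :
    degForm 1 r v = 0 := by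
  obtain ⟨j, hj, q, hq, rfl⟩ := Submodule.mem_sup.mp hr
  rw [degForm_add, degForm_one_eq_zero_of_mem_jac hf hv hj,
    degForm_eq_zero_of_mem_maximalIdeal_pow (by norm_num) hq, add_zero]

/-- [OURS · L1 W4.6] **The two linear forms separate the kernel**: if `x, y` generate `𝔪` modulo
`(∂f) + 𝔪²` then a kernel vector `v` (`degForm 1 (∂ₛf) v = 0` for all `s`) with `x₁(v) = y₁(v) = 0` is
zero — every coordinate `v_t = degForm 1 X_t v` is a combination of `x₁(v), y₁(v)`. [folklore] -/
theorem kernel_vec_eq_zero_of_degForm_one_eq_zero {f : MvPowerSeries (Fin n) κ}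
    (hf : ∀ s, coeff (Finsupp.single s 1) f = 0) {x y : MvPowerSeries (Fin n) κ}
    (hgen : ∀ m ∈ maximalIdeal (MvPowerSeries (Fin n) κ), ∃ α β : κ,
      m - (C α * x + C β * y) ∈ Ideal.span (Set.range fun s => MvPowerSeries.pderiv s f) ⊔
        maximalIdeal (MvPowerSeries (Fin n) κ) ^ 2)
    {v : Fin n → κ} (hv : ∀ s, degForm 1 (MvPowerSeries.pderiv s f) v = 0)
    (hx : degForm 1 x v = 0) (hy : degForm 1 y v = 0) : v = 0 := by
  funext t
  obtain ⟨α, β, hr⟩ := hgen (X t)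
    (Literature.RingTheory.MvPowerSeries.Jets.mem_maximalIdeal_iff_constantCoeff_eq_zero.mpr (constantCoeff_X t))
  have h := degForm_one_eq_zero_of_mem_jac_sup_sq hf hv hr
  rw [sub_eq_add_neg, degForm_add, show -(C α * x + C β * y) = (-1 : κ) • (C α * x + C β * y) by
      rw [neg_one_smul], degForm_smul, degForm_add, degForm_C_mul, degForm_C_mul, hx, hy, mul_zero,
    mul_zero, add_zero, mul_zero, add_zero, degForm_one_eq] at h
  rw [Finset.sum_eq_single t] at h
  · rwa [coeff_index_single_self_X, one_mul] at h
  · intro s _ hs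
    rw [coeff_index_single_X, if_neg hs, zero_mul]
  · intro ht; exact absurd (Finset.mem_univ t) ht

/-- [OURS · L1 W4.6] **The kernel realises every pair of values of `(x₁, y₁)`** (double state, `e = 2`,
characteristic two): the linear map `v ↦ (x₁(v), y₁(v))` from the `2`-dimensional kernel of the polar
form is injective, hence surjective. [folklore] -/
theorem exists_kernel_vec_degForm_one_eq [CharP κ 2] {c : (Fin n → ℕ) → κ} (hM : MultP 2 n κ c)
    (he : milnorEmbDim 2 n κ c = 2) {x y : MvPowerSeries (Fin n) κ}
    (hgen : ∀ m ∈ maximalIdeal (MvPowerSeries (Fin n) κ), ∃ α β : κ,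
      m - (C α * x + C β * y) ∈ Ideal.span (Set.range fun s => MvPowerSeries.pderiv s (ser 2 n κ c)) ⊔
        maximalIdeal (MvPowerSeries (Fin n) κ) ^ 2)
    (a b : κ) :
    ∃ v : Fin n → κ, Matrix.vecMul v (polarMatrix (ser 2 n κ c)) = 0 ∧ degForm 1 x v = a ∧ degForm 1 y v = b := by
  have hf' := ((FormalCoordChange.two_le_order_iff _).mp (two_le_order_ser hM)).2
  set K := LinearMap.ker (polarMatrix (ser 2 n κ c)).mulVecLin with hK
  have hfrK : Module.finrank κ K = 2 := by rw [hK, finrank_ker_polarMatrix hM, he]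
  -- the evaluation map `v ↦ (x₁(v), y₁(v))` as a `2 × n` matrix
  set M : Matrix (Fin 2) (Fin n) κ :=
    Matrix.of ![fun t => coeff (Finsupp.single t 1) x, fun t => coeff (Finsupp.single t 1) y] with hMdef
  have hM0 : ∀ v : Fin n → κ, Matrix.mulVec M v 0 = degForm 1 x v := fun v => by
    rw [Matrix.mulVec, dotProduct, degForm_one_eq]; rfl
  have hM1 : ∀ v : Fin n → κ, Matrix.mulVec M v 1 = degForm 1 y v := fun v => by
    rw [Matrix.mulVec, dotProduct, degForm_one_eq]; rfl
  set ψ : K →ₗ[κ] (Fin 2 → κ) := M.mulVecLin.comp K.subtype with hψ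
  have hψ0 : ∀ v : K, ψ v 0 = degForm 1 x (v : Fin n → κ) := fun v => hM0 v
  have hψ1 : ∀ v : K, ψ v 1 = degForm 1 y (v : Fin n → κ) := fun v => hM1 v
  have hinj : Function.Injective ψ := by
    intro v w hvw
    apply Subtype.ext
    have hd : (v : Fin n → κ) - (w : Fin n → κ) ∈ K := K.sub_mem v.2 w.2
    have hker : Matrix.vecMul ((v : Fin n → κ) - (w : Fin n → κ)) (polarMatrix (ser 2 n κ c)) = 0 :=
      (mem_ker_polarMatrix_iff _ _).mp hd
    have hv' : ∀ s, degForm 1 (MvPowerSeries.pderiv s (ser 2 n κ c)) ((v : Fin n → κ) - (w : Fin n → κ)) = 0 :=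
      fun s => by rw [degForm_one_pderiv_eq_vecMul, hker, Pi.zero_apply]
    have h0 : ψ (v - w) = 0 := by rw [map_sub, hvw, sub_self]
    have hx : degForm 1 x ((v : Fin n → κ) - (w : Fin n → κ)) = 0 := by
      rw [← Submodule.coe_sub, ← hψ0, h0, Pi.zero_apply]
    have hy : degForm 1 y ((v : Fin n → κ) - (w : Fin n → κ)) = 0 := by
      rw [← Submodule.coe_sub, ← hψ1, h0, Pi.zero_apply]
    exact sub_eq_zero.mp (kernel_vec_eq_zero_of_degForm_one_eq_zero hf' hgen hv' hx hy)
  haveI : FiniteDimensional κ K := Module.finite_of_finrank_pos (by rw [hfrK]; norm_num)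
  have hsurj : Function.Surjective ψ :=
    (LinearMap.injective_iff_surjective_of_finrank_eq_finrank (by rw [hfrK, Module.finrank_fin_fun])).mp hinj
  obtain ⟨v, hv⟩ := hsurj ![a, b]
  refine ⟨(v : Fin n → κ), (mem_ker_polarMatrix_iff _ _).mp v.2, ?_, ?_⟩
  · rw [← hψ0, hv]; rfl
  · rw [← hψ1, hv]; rfl

/-! ## The converse link -/

/-- [OURS · L1 W4.6] `𝔪 · (∂f) ≤ 𝔪²` when `f` has no linear terms. [folklore] -/
theorem maximalIdeal_mul_jac_le_sq {f : MvPowerSeries (Fin n) κ} (hf : ∀ s, coeff (Finsupp.single s 1) f = 0) :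
    maximalIdeal (MvPowerSeries (Fin n) κ) * Ideal.span (Set.range fun s => MvPowerSeries.pderiv s f) ≤
      maximalIdeal (MvPowerSeries (Fin n) κ) ^ 2 := by
  rw [pow_two]
  exact Ideal.mul_mono_right (Ideal.span_le.mpr (by rintro _ ⟨s, rfl⟩; exact pderiv_mem_maximalIdeal hf s))

/-- [OURS · L1 W4.6] **An element of `(∂f) ∩ 𝔪²` is a kernel directional derivative plus an element of
`𝔪·(∂f)`** (characteristic two, `f` of order `≥ 2`): `j = Σₛ λₛ ∂ₛ f + r`, `λ · P = 0`, `r ∈ 𝔪·(∂f)`.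
[folklore] -/
theorem exists_kernel_decomp_of_mem_jac_of_mem_sq [CharP κ 2] {f : MvPowerSeries (Fin n) κ} (hf2 : 2 ≤ f.order)
    {j : MvPowerSeries (Fin n) κ} (hj : j ∈ Ideal.span (Set.range fun s => MvPowerSeries.pderiv s f))
    (hj2 : j ∈ maximalIdeal (MvPowerSeries (Fin n) κ) ^ 2) :
    ∃ (lam : Fin n → κ) (r : MvPowerSeries (Fin n) κ), Matrix.vecMul lam (polarMatrix f) = 0 ∧
      r ∈ maximalIdeal (MvPowerSeries (Fin n) κ) * Ideal.span (Set.range fun s => MvPowerSeries.pderiv s f) ∧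
      j = ∑ s, C (lam s) * MvPowerSeries.pderiv s f + r := by
  have hf' := ((FormalCoordChange.two_le_order_iff f).mp hf2).2
  obtain ⟨g, rfl⟩ := Ideal.mem_span_range_iff_exists_fun.mp hj
  set lam : Fin n → κ := fun s => constantCoeff (g s) with hlam
  set r := ∑ s, (g s - C (lam s)) * MvPowerSeries.pderiv s f with hr
  have hsplit : ∑ s, g s * MvPowerSeries.pderiv s f = ∑ s, C (lam s) * MvPowerSeries.pderiv s f + r := by
    rw [hr, ← Finset.sum_add_distrib]
    exact Finset.sum_congr rfl fun s _ => by ring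
  have hrmem : r ∈ maximalIdeal (MvPowerSeries (Fin n) κ) *
      Ideal.span (Set.range fun s => MvPowerSeries.pderiv s f) := by
    refine Ideal.sum_mem _ fun s _ => Ideal.mul_mem_mul ?_ (Ideal.subset_span ⟨s, rfl⟩)
    rw [Literature.RingTheory.MvPowerSeries.Jets.mem_maximalIdeal_iff_constantCoeff_eq_zero, map_sub,
      constantCoeff_C, hlam, sub_self]
  refine ⟨lam, r, ?_, hrmem, hsplit⟩
  -- the linear part of `j` vanishes, and it is `λ · P` plus the (vanishing) linear part of `r`
  funext t
  have hjt : coeff (Finsupp.single t 1) (∑ s, g s * MvPowerSeries.pderiv s f) = 0 :=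
    (Literature.RingTheory.MvPowerSeries.Jets.mem_maximalIdeal_pow_iff.mp hj2) _
      (by rw [Finsupp.degree_single]; norm_num)
  have hrt : coeff (Finsupp.single t 1) r = 0 :=
    (Literature.RingTheory.MvPowerSeries.Jets.mem_maximalIdeal_pow_iff.mp (maximalIdeal_mul_jac_le_sq hf' hrmem)) _
      (by rw [Finsupp.degree_single]; norm_num)
  rw [hsplit, map_add, hrt, add_zero, coeff_single_sum_C_mul_pderiv] at hjt
  rw [hjt, Pi.zero_apply]

/-- [OURS · L1 W4.6 rung (ii) at `p = 2`, every dimension; NOT a statement of the manuscript] **IF ALL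
POLARS OF THE TANGENT CUBIC VANISH ON THE KERNEL PLANE THEN `h₂ = 3`.** For a double state `c` of
`z² = a(u₁,…,uₙ)` (any field of characteristic `2`) with `e(c) = 2`: if `Σₛ λₛ · degForm 2 (∂ₛ a) v = 0`
for all kernel vectors `λ, v` of the polar form, then `h₂(c) = 3` (the six classes `1, x, y, x², xy, y²`
are independent in `κ⟦u⟧/((∂a) + 𝔪³)`, which therefore has dimension `6 = h₂ + 3`). [folklore] -/
theorem hypersurface_milnorHilbertTwo_eq_three_of_polar_eq_zero [CharP κ 2] (c : (Fin n → ℕ) → κ)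
    (hM : MultP 2 n κ c) (he : milnorEmbDim 2 n κ c = 2)
    (hpol : ∀ lam v : Fin n → κ, Matrix.vecMul lam (polarMatrix (ser 2 n κ c)) = 0 →
      Matrix.vecMul v (polarMatrix (ser 2 n κ c)) = 0 →
        ∑ s, lam s * degForm 2 (MvPowerSeries.pderiv s (ser 2 n κ c)) v = 0) :
    milnorHilbertTwo 2 n κ c = 3 := by
  set f := ser 2 n κ c with hfdef
  have hord : 2 ≤ f.order := two_le_order_ser hM
  have hf' := ((FormalCoordChange.two_le_order_iff f).mp hord).2
  have h3 : jetTwoColength f = 3 := by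
    have h := (milnorEmbDim_le_and_mod_two hM).2.2
    rw [← hfdef] at h
    rw [h, he]
  have hr := milnorHilbertTwo_range hM he
  set J := Ideal.span (Set.range fun s => MvPowerSeries.pderiv s f) with hJ
  set I3 := J ⊔ maximalIdeal (MvPowerSeries (Fin n) κ) ^ 3 with hI3
  have hfr3 : Module.finrank κ (MvPowerSeries (Fin n) κ ⧸ I3) = milnorHilbertTwo 2 n κ c + 3 := hr.2.2
  haveI : Module.Finite κ (MvPowerSeries (Fin n) κ ⧸ I3) := Module.finite_of_finrank_pos (by omega)
  obtain ⟨a, b, hgen⟩ := exists_linear_pair_of_jetTwoColength_eq_three hf' h3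
  set x : MvPowerSeries (Fin n) κ := ∑ s, C (a s) * X s with hx
  set y : MvPowerSeries (Fin n) κ := ∑ s, C (b s) * X s with hy
  have hxm : x ∈ maximalIdeal (MvPowerSeries (Fin n) κ) := sum_C_mul_X_mem_maximalIdeal a
  have hym : y ∈ maximalIdeal (MvPowerSeries (Fin n) κ) := sum_C_mul_X_mem_maximalIdeal b
  have hx0 := Literature.RingTheory.MvPowerSeries.Jets.mem_maximalIdeal_iff_constantCoeff_eq_zero.mp hxm
  have hy0 := Literature.RingTheory.MvPowerSeries.Jets.mem_maximalIdeal_iff_constantCoeff_eq_zero.mp hym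
  set v6 : Fin 6 → MvPowerSeries (Fin n) κ ⧸ I3 := ![Ideal.Quotient.mk I3 1, Ideal.Quotient.mk I3 x,
    Ideal.Quotient.mk I3 y, Ideal.Quotient.mk I3 (x ^ 2), Ideal.Quotient.mk I3 (x * y),
    Ideal.Quotient.mk I3 (y ^ 2)] with hv6
  -- the six classes are independent
  have hli : LinearIndependent κ v6 := by
    rw [Fintype.linearIndependent_iff]
    intro g hg
    -- the relation as an element of `I3`
    have hE0 : C (g 0) * 1 + C (g 1) * x + C (g 2) * y + C (g 3) * x ^ 2 + C (g 4) * (x * y) +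
        C (g 5) * y ^ 2 ∈ I3 := by
      rw [← Ideal.Quotient.eq_zero_iff_mem, ← hg, Fin.sum_univ_six]
      simp only [hv6, Matrix.cons_val_zero, Matrix.cons_val_one, Matrix.cons_val, map_add, mk_C_mul]
    have hE : C (g 0) * 1 + C (g 1) * x + C (g 2) * y +
        (C (g 3) * x ^ 2 + C (g 4) * (x * y) + C (g 5) * y ^ 2) ∈ I3 := by
      have h : C (g 0) * 1 + C (g 1) * x + C (g 2) * y + (C (g 3) * x ^ 2 + C (g 4) * (x * y) + C (g 5) * y ^ 2) =
          C (g 0) * 1 + C (g 1) * x + C (g 2) * y + C (g 3) * x ^ 2 + C (g 4) * (x * y) + C (g 5) * y ^ 2 := by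
        ring
      rw [h]
      exact hE0
    -- Step 1: the linear part of the relation is trivial
    have hquad_sq : C (g 3) * x ^ 2 + C (g 4) * (x * y) + C (g 5) * y ^ 2 ∈
        maximalIdeal (MvPowerSeries (Fin n) κ) ^ 2 := by
      rw [pow_two (maximalIdeal _), pow_two, pow_two]
      exact Ideal.add_mem _ (Ideal.add_mem _ (Ideal.mul_mem_left _ _ (Ideal.mul_mem_mul hxm hxm))
        (Ideal.mul_mem_left _ _ (Ideal.mul_mem_mul hxm hym))) (Ideal.mul_mem_left _ _ (Ideal.mul_mem_mul hym hym))
    have hI3le : I3 ≤ J ⊔ maximalIdeal (MvPowerSeries (Fin n) κ) ^ 2 :=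
      sup_le_sup_left (Ideal.pow_le_pow_right (by norm_num)) _
    have hlin : C (g 0) + C (g 1) * x + C (g 2) * y ∈ J ⊔ maximalIdeal (MvPowerSeries (Fin n) κ) ^ 2 := by
      have h := Ideal.sub_mem _ (hI3le hE) (Ideal.mem_sup_right hquad_sq : _ ∈ J ⊔ _)
      rwa [add_sub_cancel_right, mul_one] at h
    obtain ⟨hg0, hg1, hg2⟩ := coeffs_eq_zero_of_linear_mem h3 hgen hlin
    -- Step 2: the quadratic relation `q ∈ (∂f) + 𝔪³`
    have hq : C (g 3) * x ^ 2 + C (g 4) * (x * y) + C (g 5) * y ^ 2 ∈ I3 := by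
      have h := hE
      rwa [hg0, hg1, hg2, map_zero, zero_mul, zero_mul, zero_mul, zero_add, zero_add, zero_add] at h
    obtain ⟨j, hj, m3, hm3, hjm⟩ := Submodule.mem_sup.mp hq
    have hj2 : j ∈ maximalIdeal (MvPowerSeries (Fin n) κ) ^ 2 := by
      have h : j = (C (g 3) * x ^ 2 + C (g 4) * (x * y) + C (g 5) * y ^ 2) - m3 := by rw [← hjm]; ring
      rw [h]
      exact Ideal.sub_mem _ hquad_sq (Ideal.pow_le_pow_right (by norm_num) hm3)
    obtain ⟨lam, r, hlam, hrmem, hjdec⟩ := exists_kernel_decomp_of_mem_jac_of_mem_sq hord hj hj2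
    -- evaluation at kernel vectors: `g₃ X² + g₄ XY + g₅ Y² = 0` on the kernel
    have heval : ∀ v : Fin n → κ, Matrix.vecMul v (polarMatrix f) = 0 →
        g 3 * degForm 1 x v ^ 2 + g 4 * (degForm 1 x v * degForm 1 y v) + g 5 * degForm 1 y v ^ 2 = 0 := by
      intro v hv
      have hv' : ∀ s, degForm 1 (MvPowerSeries.pderiv s f) v = 0 := fun s => by
        rw [degForm_one_pderiv_eq_vecMul, hv, Pi.zero_apply]
      have h1 : degForm 2 (C (g 3) * x ^ 2 + C (g 4) * (x * y) + C (g 5) * y ^ 2) v =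
          g 3 * degForm 1 x v ^ 2 + g 4 * (degForm 1 x v * degForm 1 y v) + g 5 * degForm 1 y v ^ 2 := by
        rw [degForm_add, degForm_add, degForm_C_mul, degForm_C_mul, degForm_C_mul, pow_two, pow_two,
          degForm_two_mul hx0 hx0, degForm_two_mul hx0 hy0, degForm_two_mul hy0 hy0]
        ring
      have h2 : degForm 2 (C (g 3) * x ^ 2 + C (g 4) * (x * y) + C (g 5) * y ^ 2) v = 0 := by
        rw [← hjm, degForm_add, degForm_eq_zero_of_mem_maximalIdeal_pow (by norm_num) hm3, add_zero, hjdec,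
          degForm_add, degForm_two_sum_C_mul_pderiv, hpol lam v hlam hv,
          degForm_two_eq_zero_of_mem_maximalIdeal_mul_jac hf' hv' (Ideal.mem_sup_left hrmem), add_zero]
      rw [← h1, h2]
    obtain ⟨v₁, hv₁, hx₁, hy₁⟩ := exists_kernel_vec_degForm_one_eq hM he hgen 1 0
    obtain ⟨v₂, hv₂, hx₂, hy₂⟩ := exists_kernel_vec_degForm_one_eq hM he hgen 0 1
    obtain ⟨v₃, hv₃, hx₃, hy₃⟩ := exists_kernel_vec_degForm_one_eq hM he hgen 1 1
    have e₁ := heval v₁ hv₁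
    have e₂ := heval v₂ hv₂
    have e₃ := heval v₃ hv₃
    rw [hx₁, hy₁] at e₁
    rw [hx₂, hy₂] at e₂
    rw [hx₃, hy₃] at e₃
    have hg3 : g 3 = 0 := by linear_combination e₁
    have hg5 : g 5 = 0 := by linear_combination e₂
    have hg4 : g 4 = 0 := by linear_combination e₃ - e₁ - e₂
    intro i
    fin_cases i
    · exact hg0
    · exact hg1
    · exact hg2
    · exact hg3
    · exact hg4
    · exact hg5
  have hcard := hli.fintype_card_le_finrank
  rw [Fintype.card_fin, hfr3] at hcard
  omega

/-- [OURS · L1 W4.6 rung (ii) at `p = 2`, every dimension; NOT a statement of the manuscript] **THE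
LINK, BOTH WAYS: at corank two, `h₂ = 3` IFF THE TANGENT CUBIC VANISHES ON THE KERNEL PLANE AS A FORM**
— for a double state `c` of `z² = a(u₁,…,uₙ)` over any field of characteristic `2` with `e(c) = 2`:
`h₂(c) = 3 ↔ ∀ λ v ∈ ker P, Σₛ λₛ · degForm 2 (∂ₛ a) v = 0` (all polars of `a₃` vanish on `ker P`; this
implies `a₃ ≡ 0` on `ker P` by Euler, and over fields with more than two elements is equivalent to it).
So gen 4's «no tangent cubic» class `(e, h₂) = (2, 3)` — the only door through which the forced
procedure leaves the isolated regime sideways (p518449) — is READ OFF THE 3-JET: the cubic form of the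
cleaned state restricted to the kernel plane of its polar form is zero. [folklore] -/
theorem hypersurface_milnorHilbertTwo_eq_three_iff_polar [CharP κ 2] (c : (Fin n → ℕ) → κ)
    (hM : MultP 2 n κ c) (he : milnorEmbDim 2 n κ c = 2) :
    milnorHilbertTwo 2 n κ c = 3 ↔
      ∀ lam v : Fin n → κ, Matrix.vecMul lam (polarMatrix (ser 2 n κ c)) = 0 →
        Matrix.vecMul v (polarMatrix (ser 2 n κ c)) = 0 →
          ∑ s, lam s * degForm 2 (MvPowerSeries.pderiv s (ser 2 n κ c)) v = 0 :=
  ⟨fun hh _ _ hlam hv => hypersurface_polar_eq_zero_of_milnorHilbertTwo_eq_three c hM he hh hlam hv,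
    hypersurface_milnorHilbertTwo_eq_three_of_polar_eq_zero c hM he⟩

/-- [OURS · L1 W4.6 rung (ii) at `p = 2`, every dimension; NOT a statement of the manuscript] **`h₂ ≤ 2`
IFF SOME POLAR OF THE TANGENT CUBIC IS NON-ZERO ON THE KERNEL PLANE** (corank two; contrapositive of the
previous theorem with the range `h₂ ∈ {1,2,3}`). Then, for an isolated state, every double successor is
isolated (gen 4). [folklore] -/
theorem hypersurface_milnorHilbertTwo_le_two_iff_polar [CharP κ 2] (c : (Fin n → ℕ) → κ)
    (hM : MultP 2 n κ c) (he : milnorEmbDim 2 n κ c = 2) :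
    milnorHilbertTwo 2 n κ c ≤ 2 ↔
      ∃ lam v : Fin n → κ, Matrix.vecMul lam (polarMatrix (ser 2 n κ c)) = 0 ∧
        Matrix.vecMul v (polarMatrix (ser 2 n κ c)) = 0 ∧
          ∑ s, lam s * degForm 2 (MvPowerSeries.pderiv s (ser 2 n κ c)) v ≠ 0 := by
  have hr := milnorHilbertTwo_range hM he
  have h := hypersurface_milnorHilbertTwo_eq_three_iff_polar c hM he
  constructor
  · intro hle
    by_contra hne
    push Not at hne
    have h3 := h.mpr fun lam v hl hv => hne lam v hl hv
    omega
  · rintro ⟨lam, v, hl, hv, hne⟩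
    by_contra hgt
    exact hne (h.mp (by omega) lam v hl hv)

end CampaignW46.HypersurfacesCharTwo

end Summit.ResolutionOfSingularities.ResolutionOfSingularities.Theorems

end
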